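import Mathlib.Analysis.Complex.CauchyIntegral
import Mathlib.Analysis.Analytic.IsolatedZeros
import Mathlib.Analysis.Analytic.Uniqueness
import Mathlib.Analysis.InnerProductSpace.Basic
import Mathlib.Analysis.Complex.Convex
import Mathlib.Topology.MetricSpace.Pseudo.Lemmas
import Mathlib.Order.ConditionallyCompleteLattice.Basic
import HarnessLib

/-!
# Continuation of holomorphic roots of a polynomial over a disc

Topic `Literature/Analysis/Complex` (namespace `Literature.Analysis.Complex.RootContinuation`).
Everything here is PROVED (no definitions, no named facts).

Let `b₀, …, b_d` be functions on the disc `D = {|q| < R}` and write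
`𝒬(q, w) = Σₙ bₙ(q) wⁿ`. Suppose that `𝒬` has **local holomorphic root systems everywhere on
`D`**: every `q₀ ∈ D` has a neighbourhood `|q - q₀| < ε` carrying finitely many holomorphic
functions `Y₁, …, Y_m` which are roots of `𝒬(q, ·)` and such that every root of `𝒬(q, ·)`,
`q` in that neighbourhood (and in `D`), is one of the values `Yᵢ(q)`. (This is the situation of an
algebraic function without branch points over `D`, the roots being allowed to cross.) **Then every
holomorphic root of `𝒬` on a small disc `|q| < r₀` extends to a holomorphic root on all of `D`**
(`exists_holomorphic_root_extend`) — the monodromy theorem for algebraic functions over a disc,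
proved here without paths or coverings: if `s < R` is the supremum of the radii of discs to which
the root extends, the extension `y` to `|q| < s` is matched, on each lens
`{|q - x| < ℓ} ∩ {|q| < s}` (`|x| = s`, `ℓ` a Lebesgue number of the circle for the local root
systems), with one of the local roots (a holomorphic function taking pointwise the values of
finitely many holomorphic functions on a connected open set coincides with one of them,
`exists_eqOn_of_forall_exists_eq`), and these matched roots glue along the circle (two lenses
with centres on the circle that meet, meet inside the disc — parallelogram law) to a root on
`|q| < s + ℓ/2`.

Also: `eqOn_of_eqOn_ball` (identity theorem from a small disc), the radial projection estimates.

Written for the analytic proof that Galois conjugates of (noncongruence) modular forms are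
modular forms (Calegari–Dimitrov–Tang, *The unbounded denominators conjecture*, Remark 59): the
conjugates of the roots of the minimal polynomial of a modular function over `ℂ(λ)` are continued
over the `q`-disc. [folklore]

## References

* O. Forster, *Lectures on Riemann Surfaces*, GTM 81, Springer 1981, §8 (algebraic functions;
  Thm. 8.9 and the monodromy theorem 4.10). [folklore]
-/

noncomputable section

open Complex Filter Topology Set Metric Finset
open scoped Real

namespace Literature.Analysis.Complex

namespace RootContinuation

/-! ### 1. A holomorphic function taking the values of finitely many holomorphic functions -/

/-- **Finite pointwise coincidence forces identical coincidence.** If `f` and `g₁, …, g_m` are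
analytic on a preconnected open set `U ∋ z₀` and at every point of `U` the value of `f` is one
of the values `gᵢ`, then `f = gᵢ` on `U` for one `i` (analytic germs at `z₀` form an integral
domain: if no `f - gᵢ` vanishes near `z₀`, all are non-zero on a punctured neighbourhood).
[folklore] -/
theorem exists_eqOn_of_forall_exists_eq {ι : Type*} [Finite ι] {U : Set ℂ} (hU : IsOpen U)
    (hUc : IsPreconnected U) {z₀ : ℂ} (hz₀ : z₀ ∈ U) {f : ℂ → ℂ} {g : ι → ℂ → ℂ}
    (hf : AnalyticOnNhd ℂ f U) (hg : ∀ i, AnalyticOnNhd ℂ (g i) U)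
    (h : ∀ z ∈ U, ∃ i, f z = g i z) : ∃ i, EqOn f (g i) U := by
  by_contra hne
  push Not at hne
  -- no `f - g i` vanishes identically near `z₀`
  have hloc : ∀ i, ∀ᶠ z in 𝓝[≠] z₀, f z ≠ g i z := by
    intro i
    rcases ((hf z₀ hz₀).sub (hg i z₀ hz₀)).eventually_eq_zero_or_eventually_ne_zero with h0 | h0
    · exfalso
      refine hne i (hf.eqOn_of_preconnected_of_eventuallyEq (hg i) hUc hz₀ ?_)
      filter_upwards [h0] with z hz
      simpa [sub_eq_zero] using hz
    · filter_upwards [h0] with z hz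
      simpa [sub_eq_zero] using hz
  have hall : ∀ᶠ z in 𝓝[≠] z₀, ∀ i, f z ≠ g i z := Filter.eventually_all.mpr hloc
  have hmem : ∀ᶠ z in 𝓝[≠] z₀, z ∈ U := eventually_nhdsWithin_of_eventually_nhds (hU.mem_nhds hz₀)
  obtain ⟨z, hz, hzU⟩ := (hall.and hmem).exists
  obtain ⟨i, hi⟩ := h z hzU
  exact hz i hi

/-- **Identity theorem from a small disc**: two functions holomorphic on the disc `|q - c| < r`
that agree on `|q - c| < r'` (`0 < r'`) agree on the whole disc. [folklore] -/
theorem eqOn_of_eqOn_ball {f g : ℂ → ℂ} {c : ℂ} {r r' : ℝ} (hr' : 0 < r')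
    (hf : DifferentiableOn ℂ f (ball c r)) (hg : DifferentiableOn ℂ g (ball c r))
    (h : EqOn f g (ball c r')) : EqOn f g (ball c r) := by
  rcases le_or_gt r r' with hle | hlt
  · exact fun z hz ↦ h (ball_subset_ball hle hz)
  · have hc : c ∈ ball c r := mem_ball_self (hr'.trans hlt)
    refine (hf.analyticOnNhd isOpen_ball).eqOn_of_preconnected_of_eventuallyEq
      (hg.analyticOnNhd isOpen_ball) (convex_ball c r).isPreconnected hc ?_
    exact h.eventuallyEq_of_mem (ball_mem_nhds c hr')

/-! ### 2. Geometry: radial projection to a circle, lenses -/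

/-- The radial projection `x(q) = (s/|q|) q` of `q ≠ 0` has norm `s` (`0 ≤ s`). [folklore] -/
theorem norm_radialProj {q : ℂ} (hq : q ≠ 0) {s : ℝ} (hs : 0 ≤ s) :
    ‖((s / ‖q‖ : ℝ) : ℂ) * q‖ = s := by
  rw [norm_mul, Complex.norm_real, Real.norm_of_nonneg (div_nonneg hs (norm_nonneg q)),
    div_mul_cancel₀ s (norm_ne_zero_iff.mpr hq)]

/-- Distance from `q` to its radial projection: `|q - x(q)| = |‖q‖ - s|`. [folklore] -/
theorem norm_sub_radialProj {q : ℂ} (hq : q ≠ 0) (s : ℝ) :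
    ‖q - ((s / ‖q‖ : ℝ) : ℂ) * q‖ = |‖q‖ - s| := by
  have hq' : ‖q‖ ≠ 0 := norm_ne_zero_iff.mpr hq
  have : q - ((s / ‖q‖ : ℝ) : ℂ) * q = (((1 - s / ‖q‖ : ℝ)) : ℂ) * q := by
    push_cast
    ring
  rw [this, norm_mul, Complex.norm_real, Real.norm_eq_abs]
  rw [show (1 - s / ‖q‖) = (‖q‖ - s) / ‖q‖ by field_simp, abs_div, abs_of_pos (norm_pos_iff.mpr hq),
    div_mul_cancel₀ _ hq']

/-- **The midpoint of two distinct points of norm `s` has norm `< s`** (strict convexity of the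
Euclidean norm, from the parallelogram law). [folklore] -/
theorem norm_midpoint_lt {x₁ x₂ : ℂ} {s : ℝ} (h₁ : ‖x₁‖ = s) (h₂ : ‖x₂‖ = s) (hne : x₁ ≠ x₂) :
    ‖(x₁ + x₂) / 2‖ < s := by
  have hpar : ‖x₁ + x₂‖ ^ 2 + ‖x₁ - x₂‖ ^ 2 = 2 * (‖x₁‖ ^ 2 + ‖x₂‖ ^ 2) :=
    parallelogram_law_with_norm ℝ x₁ x₂
  have hpos : 0 < ‖x₁ - x₂‖ := norm_pos_iff.mpr (sub_ne_zero.mpr hne)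
  have hs : 0 ≤ s := h₁ ▸ norm_nonneg x₁
  rw [h₁, h₂] at hpar
  have hlt : ‖x₁ + x₂‖ ^ 2 < (2 * s) ^ 2 := by nlinarith
  have h2 : ‖x₁ + x₂‖ < 2 * s := by
    by_contra hge
    push Not at hge
    nlinarith [norm_nonneg (x₁ + x₂)]
  rw [norm_div, RCLike.norm_ofNat]
  linarith

/-! ### 3. The continuation theorem -/

/-- **Continuation of a holomorphic root over a disc.** Let `𝒬(q, w) = Σ_{n ≤ d} bₙ(q) wⁿ` on
the disc `|q| < R` have local holomorphic root systems everywhere: for every `q₀` in the disc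
there are `ε > 0` and finitely many `Yᵢ` holomorphic on `|q - q₀| < ε` which are roots of
`𝒬(q, ·)` there (for `|q| < R`) and such that every root of `𝒬(q, ·)` there is one of the
`Yᵢ(q)`. Then a holomorphic root `y₀` of `𝒬` on `|q| < r₀` (`0 < r₀ ≤ R`) extends to a
holomorphic root on `|q| < R`. [folklore] -/
theorem exists_holomorphic_root_extend {d : ℕ} {b : ℕ → ℂ → ℂ} {R : ℝ}
    (hloc : ∀ q₀ ∈ ball (0 : ℂ) R, ∃ ε > 0, ∃ (m : ℕ) (Y : Fin m → ℂ → ℂ),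
      (∀ i, DifferentiableOn ℂ (Y i) (ball q₀ ε)) ∧
      (∀ i, ∀ q ∈ ball q₀ ε, q ∈ ball (0 : ℂ) R →
        ∑ n ∈ range (d + 1), b n q * Y i q ^ n = 0) ∧
      ∀ q ∈ ball q₀ ε, q ∈ ball (0 : ℂ) R → ∀ w : ℂ,
        ∑ n ∈ range (d + 1), b n q * w ^ n = 0 → ∃ i, w = Y i q)
    {r₀ : ℝ} (hr₀ : 0 < r₀) (hr₀R : r₀ ≤ R) {y₀ : ℂ → ℂ}
    (hy₀ : DifferentiableOn ℂ y₀ (ball 0 r₀))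
    (hy₀root : ∀ q ∈ ball (0 : ℂ) r₀, ∑ n ∈ range (d + 1), b n q * y₀ q ^ n = 0) :
    ∃ y : ℂ → ℂ, DifferentiableOn ℂ y (ball 0 R) ∧
      (∀ q ∈ ball (0 : ℂ) R, ∑ n ∈ range (d + 1), b n q * y q ^ n = 0) ∧
      ∀ q ∈ ball (0 : ℂ) r₀, y q = y₀ q := by
  classical
  -- ### the set of good radii and its supremum
  set Good : ℝ → (ℂ → ℂ) → Prop := fun r y ↦ DifferentiableOn ℂ y (ball 0 r) ∧
    (∀ q ∈ ball (0 : ℂ) r, ∑ n ∈ range (d + 1), b n q * y q ^ n = 0) ∧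
    ∀ q ∈ ball (0 : ℂ) r₀, y q = y₀ q with hGood
  set 𝓢 : Set ℝ := {r | r₀ ≤ r ∧ r ≤ R ∧ ∃ y, Good r y} with h𝓢
  have h𝓢r₀ : r₀ ∈ 𝓢 := ⟨le_rfl, hr₀R, y₀, hy₀, hy₀root, fun _ _ ↦ rfl⟩
  have h𝓢ne : 𝓢.Nonempty := ⟨r₀, h𝓢r₀⟩
  have h𝓢bdd : BddAbove 𝓢 := ⟨R, fun r hr ↦ hr.2.1⟩
  set s : ℝ := sSup 𝓢 with hs
  have hr₀s : r₀ ≤ s := le_csSup h𝓢bdd h𝓢r₀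
  have hsR : s ≤ R := csSup_le h𝓢ne fun r hr ↦ hr.2.1
  have hspos : 0 < s := hr₀.trans_le hr₀s
  -- two good roots agree on the common disc
  have hagree : ∀ r r' y y', Good r y → Good r' y' → ∀ q : ℂ, ‖q‖ < min r r' → y q = y' q := by
    intro r r' y y' hy hy' q hq
    have hmin : 0 < min r r' := (norm_nonneg q).trans_lt hq
    have hsub : ball (0 : ℂ) (min r r') ⊆ ball 0 r := ball_subset_ball (min_le_left _ _)
    have hsub' : ball (0 : ℂ) (min r r') ⊆ ball 0 r' := ball_subset_ball (min_le_right _ _)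
    refine eqOn_of_eqOn_ball hr₀ (hy.1.mono hsub) (hy'.1.mono hsub') (fun z hz ↦ ?_)
      (mem_ball_zero_iff.mpr hq)
    rw [hy.2.2 z hz, hy'.2.2 z hz]
  -- ### Step 1: `s` is good
  have hsgood : ∃ y, Good s y := by
    have hex : ∀ r ∈ 𝓢, ∃ y, Good r y := fun r hr ↦ hr.2.2
    choose! yr hyr using hex
    have hlt : ∀ q ∈ ball (0 : ℂ) s, ∃ r ∈ 𝓢, ‖q‖ < r := fun q hq ↦
      exists_lt_of_lt_csSup h𝓢ne (by rwa [mem_ball_zero_iff] at hq)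
    choose! ρ hρ hρlt using hlt
    refine ⟨fun q ↦ yr (ρ q) q, ?_, ?_, ?_⟩
    · intro q₁ hq₁
      have hρ₁ := hρ q₁ hq₁
      have hlt₁ := hρlt q₁ hq₁
      -- near `q₁` the glued function is `yr (ρ q₁)`
      have hev : (fun q ↦ yr (ρ q) q) =ᶠ[𝓝 q₁] yr (ρ q₁) := by
        have h1 : ∀ᶠ q in 𝓝 q₁, q ∈ ball (0 : ℂ) s := isOpen_ball.mem_nhds hq₁
        have h2 : ∀ᶠ q in 𝓝 q₁, ‖q‖ < ρ q₁ :=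
          (continuous_norm.continuousAt (x := q₁)).eventually (Iio_mem_nhds hlt₁)
        filter_upwards [h1, h2] with q hq hq2
        exact hagree _ _ _ _ (hyr _ (hρ q hq)) (hyr _ hρ₁) q (lt_min (hρlt q hq) hq2)
      have hd : DifferentiableAt ℂ (yr (ρ q₁)) q₁ :=
        (hyr _ hρ₁).1.differentiableAt (isOpen_ball.mem_nhds (mem_ball_zero_iff.mpr hlt₁))
      exact (hd.congr_of_eventuallyEq hev).differentiableWithinAt
    · intro q hq
      exact (hyr _ (hρ q hq)).2.1 q (mem_ball_zero_iff.mpr (hρlt q hq))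
    · intro q hq
      have hqs : q ∈ ball (0 : ℂ) s := ball_subset_ball hr₀s hq
      exact (hyr _ (hρ q hqs)).2.2 q hq
  obtain ⟨ys, hys⟩ := hsgood
  -- ### Step 2: `s = R`; suppose not
  rcases eq_or_lt_of_le hsR with hsR' | hsR'
  · exact ⟨ys, hsR' ▸ hys.1, hsR' ▸ hys.2.1, hys.2.2⟩
  exfalso
  -- local root systems along the circle `|x| = s`, with a Lebesgue number `ℓ`
  have hcirc : ∀ x ∈ sphere (0 : ℂ) s, x ∈ ball (0 : ℂ) R := fun x hx ↦ by
    rw [mem_ball_zero_iff, mem_sphere_zero_iff_norm.mp hx]; exact hsR'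
  choose! ε hε m Y hYd hYroot hYall using hloc
  obtain ⟨ℓ, hℓ, hℓcov⟩ : ∃ ℓ > 0, ∀ x ∈ sphere (0 : ℂ) s, ∃ x' ∈ sphere (0 : ℂ) s,
      ball x ℓ ⊆ ball x' (ε x') := by
    have hcpt : IsCompact (sphere (0 : ℂ) s) := isCompact_sphere 0 s
    obtain ⟨δ, hδ, hδcov⟩ := lebesgue_number_lemma_of_metric hcpt
      (c := fun x : sphere (0 : ℂ) s ↦ ball (x : ℂ) (ε x)) (fun _ ↦ isOpen_ball) (by
        intro x hx
        exact mem_iUnion.mpr ⟨⟨x, hx⟩, mem_ball_self (hε x (hcirc x hx))⟩)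
    exact ⟨δ, hδ, fun x hx ↦ by
      obtain ⟨⟨x', hx'⟩, hsub⟩ := hδcov x hx
      exact ⟨x', hx', hsub⟩⟩
  -- shrink `ℓ` so that `s + ℓ ≤ R`
  set ℓ' : ℝ := min ℓ (R - s) with hℓ'
  have hℓ' : 0 < ℓ' := lt_min hℓ (sub_pos.mpr hsR')
  have hℓ'ℓ : ℓ' ≤ ℓ := min_le_left _ _
  have hℓ'R : s + ℓ' ≤ R := by have := min_le_right ℓ (R - s); linarith
  -- ### matching: on each lens the root `ys` is one of the local roots
  have hmatch : ∀ x ∈ sphere (0 : ℂ) s, ∃ Yx : ℂ → ℂ, DifferentiableOn ℂ Yx (ball x ℓ') ∧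
      (∀ q ∈ ball x ℓ', q ∈ ball (0 : ℂ) R → ∑ n ∈ range (d + 1), b n q * Yx q ^ n = 0) ∧
      ∀ q ∈ ball x ℓ', q ∈ ball (0 : ℂ) s → Yx q = ys q := by
    intro x hx
    obtain ⟨x', hx', hsub⟩ := hℓcov x hx
    have hx'R := hcirc x' hx'
    have hsub' : ball x ℓ' ⊆ ball x' (ε x') := (ball_subset_ball hℓ'ℓ).trans hsub
    -- the lens
    set L : Set ℂ := ball x ℓ' ∩ ball 0 s with hL
    have hLo : IsOpen L := isOpen_ball.inter isOpen_ball
    have hLc : IsPreconnected L := ((convex_ball x ℓ').inter (convex_ball 0 s)).isPreconnected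
    -- a point of the lens
    have hxs : ‖x‖ = s := mem_sphere_zero_iff_norm.mp hx
    obtain ⟨p, hp⟩ : ∃ p, p ∈ L := by
      obtain ⟨t, ht0, ht1, hts⟩ : ∃ t : ℝ, 0 < t ∧ t < 1 ∧ t * s < ℓ' := by
        refine ⟨min (1 / 2) (ℓ' / (2 * s)), lt_min one_half_pos (by positivity), ?_, ?_⟩
        · exact (min_le_left _ _).trans_lt one_half_lt_one
        · calc min (1 / 2) (ℓ' / (2 * s)) * s ≤ ℓ' / (2 * s) * s :=
              mul_le_mul_of_nonneg_right (min_le_right _ _) hspos.le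
            _ = ℓ' / 2 := by field_simp
            _ < ℓ' := half_lt_self hℓ'
      refine ⟨((1 - t : ℝ) : ℂ) * x, ?_, ?_⟩
      · rw [mem_ball, dist_eq_norm, show ((1 - t : ℝ) : ℂ) * x - x = -((t : ℝ) : ℂ) * x by
          push_cast; ring, norm_mul, norm_neg, Complex.norm_real, Real.norm_of_nonneg ht0.le, hxs]
        exact hts
      · rw [mem_ball_zero_iff, norm_mul, Complex.norm_real, Real.norm_of_nonneg (by linarith), hxs]
        nlinarith
    -- pointwise the value of `ys` on the lens is a root value
    have hpt : ∀ q ∈ L, ∃ i : Fin (m x'), ys q = Y x' i q := by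
      intro q hq
      have hqR : q ∈ ball (0 : ℂ) R := ball_subset_ball hsR (mem_of_mem_inter_right hq)
      exact hYall x' hx'R q (hsub' (mem_of_mem_inter_left hq)) hqR (ys q)
        (hys.2.1 q (mem_of_mem_inter_right hq))
    have hysA : AnalyticOnNhd ℂ ys L :=
      (hys.1.analyticOnNhd isOpen_ball).mono inter_subset_right
    have hYA : ∀ i, AnalyticOnNhd ℂ (Y x' i) L := fun i ↦
      ((hYd x' hx'R i).analyticOnNhd isOpen_ball).mono (inter_subset_left.trans hsub')
    obtain ⟨i, hi⟩ := exists_eqOn_of_forall_exists_eq hLo hLc hp hysA hYA hpt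
    refine ⟨Y x' i, (hYd x' hx'R i).mono hsub', fun q hq hqR ↦ hYroot x' hx'R i q (hsub' hq) hqR,
      fun q hq hqs ↦ (hi ⟨hq, hqs⟩).symm⟩
  choose! Yx hYxd hYxroot hYxeq using hmatch
  -- two matched roots at nearby circle points agree on the intersection of their discs
  have hglue : ∀ x₁ ∈ sphere (0 : ℂ) s, ∀ x₂ ∈ sphere (0 : ℂ) s, ∀ q ∈ ball x₁ ℓ' ∩ ball x₂ ℓ',
      Yx x₁ q = Yx x₂ q := by
    intro x₁ hx₁ x₂ hx₂ q hq
    rcases eq_or_ne x₁ x₂ with rfl | hne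
    · rfl
    have h₁ : ‖x₁‖ = s := mem_sphere_zero_iff_norm.mp hx₁
    have h₂ : ‖x₂‖ = s := mem_sphere_zero_iff_norm.mp hx₂
    set V : Set ℂ := ball x₁ ℓ' ∩ ball x₂ ℓ' with hV
    have hVo : IsOpen V := isOpen_ball.inter isOpen_ball
    have hVc : IsPreconnected V := ((convex_ball x₁ ℓ').inter (convex_ball x₂ ℓ')).isPreconnected
    -- the midpoint of `x₁, x₂` lies in `V` and strictly inside the circle
    set mpt : ℂ := (x₁ + x₂) / 2 with hmpt
    have hd12 : dist x₁ x₂ < 2 * ℓ' := by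
      calc dist x₁ x₂ ≤ dist x₁ q + dist q x₂ := dist_triangle _ _ _
        _ < ℓ' + ℓ' := add_lt_add (by rw [dist_comm]; exact hq.1) hq.2
        _ = 2 * ℓ' := by ring
    have hm₁ : mpt ∈ ball x₁ ℓ' := by
      rw [mem_ball, dist_eq_norm, hmpt, show (x₁ + x₂) / 2 - x₁ = (x₂ - x₁) / 2 by ring, norm_div,
        RCLike.norm_ofNat, ← dist_eq_norm, dist_comm]
      linarith
    have hm₂ : mpt ∈ ball x₂ ℓ' := by
      rw [mem_ball, dist_eq_norm, hmpt, show (x₁ + x₂) / 2 - x₂ = (x₁ - x₂) / 2 by ring, norm_div,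
        RCLike.norm_ofNat, ← dist_eq_norm]
      linarith
    have hms : mpt ∈ ball (0 : ℂ) s := by
      rw [mem_ball_zero_iff, hmpt]
      exact norm_midpoint_lt h₁ h₂ hne
    -- `Yx x₁ = ys = Yx x₂` near the midpoint
    have hev : Yx x₁ =ᶠ[𝓝 mpt] Yx x₂ := by
      have h1 : ∀ᶠ z in 𝓝 mpt, z ∈ ball x₁ ℓ' := isOpen_ball.mem_nhds hm₁
      have h2 : ∀ᶠ z in 𝓝 mpt, z ∈ ball x₂ ℓ' := isOpen_ball.mem_nhds hm₂
      have h3 : ∀ᶠ z in 𝓝 mpt, z ∈ ball (0 : ℂ) s := isOpen_ball.mem_nhds hms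
      filter_upwards [h1, h2, h3] with z hz1 hz2 hz3
      rw [hYxeq x₁ hx₁ z hz1 hz3, hYxeq x₂ hx₂ z hz2 hz3]
    have hA₁ : AnalyticOnNhd ℂ (Yx x₁) V :=
      ((hYxd x₁ hx₁).analyticOnNhd isOpen_ball).mono inter_subset_left
    have hA₂ : AnalyticOnNhd ℂ (Yx x₂) V :=
      ((hYxd x₂ hx₂).analyticOnNhd isOpen_ball).mono inter_subset_right
    exact hA₁.eqOn_of_preconnected_of_eventuallyEq hA₂ hVc ⟨hm₁, hm₂⟩ hev hq
  -- ### the extension to `|q| < s + ℓ'/2`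
  set proj : ℂ → ℂ := fun q ↦ ((s / ‖q‖ : ℝ) : ℂ) * q with hproj
  have hproj_sph : ∀ q : ℂ, q ≠ 0 → proj q ∈ sphere (0 : ℂ) s := fun q hq ↦
    mem_sphere_zero_iff_norm.mpr (norm_radialProj hq hspos.le)
  have hproj_dist : ∀ q : ℂ, q ≠ 0 → dist q (proj q) = |‖q‖ - s| := fun q hq ↦ by
    rw [dist_eq_norm]; exact norm_sub_radialProj hq s
  set yt : ℂ → ℂ := fun q ↦ if ‖q‖ < s then ys q else Yx (proj q) q with hyt
  set s' : ℝ := s + ℓ' / 2 with hs'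
  -- near a point `q₁` with `s ≤ ‖q₁‖ < s + ℓ'/2`, `yt` is the matched root at `proj q₁`
  have hkey : ∀ q₁ : ℂ, s ≤ ‖q₁‖ → ‖q₁‖ < s' → q₁ ∈ ball (proj q₁) ℓ' ∧
      yt =ᶠ[𝓝 q₁] Yx (proj q₁) := by
    intro q₁ hq₁ hq₁'
    have hq₁0 : q₁ ≠ 0 := by
      intro h; rw [h, norm_zero] at hq₁; linarith
    have hx₁ := hproj_sph q₁ hq₁0
    have hd₁ : dist q₁ (proj q₁) < ℓ' / 2 := by
      rw [hproj_dist q₁ hq₁0, abs_of_nonneg (by linarith)]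
      linarith
    have hq₁ball : q₁ ∈ ball (proj q₁) ℓ' := mem_ball.mpr (by linarith)
    refine ⟨hq₁ball, ?_⟩
    -- an `η`-neighbourhood of `q₁`
    obtain ⟨η, hη, hηlt⟩ : ∃ η > 0, η + dist q₁ (proj q₁) < ℓ' / 2 ∧ ‖q₁‖ + η < s' :=
      ⟨min ((ℓ' / 2 - dist q₁ (proj q₁)) / 2) ((s' - ‖q₁‖) / 2),
        lt_min (by linarith) (by linarith),
        by have := min_le_left ((ℓ' / 2 - dist q₁ (proj q₁)) / 2) ((s' - ‖q₁‖) / 2); linarith,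
        by have := min_le_right ((ℓ' / 2 - dist q₁ (proj q₁)) / 2) ((s' - ‖q₁‖) / 2); linarith⟩
    filter_upwards [ball_mem_nhds q₁ hη] with q hq
    rw [mem_ball] at hq
    have hqx₁ : q ∈ ball (proj q₁) ℓ' := by
      rw [mem_ball]
      calc dist q (proj q₁) ≤ dist q q₁ + dist q₁ (proj q₁) := dist_triangle _ _ _
        _ < ℓ' := by linarith
    by_cases hqs : ‖q‖ < s
    · rw [hyt]
      simp only [if_pos hqs]
      exact (hYxeq (proj q₁) hx₁ q hqx₁ (mem_ball_zero_iff.mpr hqs)).symm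
    · rw [hyt]
      simp only [if_neg hqs]
      push Not at hqs
      have hq0 : q ≠ 0 := by
        intro h; rw [h, norm_zero] at hqs; linarith
      have hx₂ := hproj_sph q hq0
      have hqn : ‖q‖ < s' := by
        have : ‖q‖ ≤ ‖q₁‖ + dist q q₁ := by
          rw [dist_eq_norm]
          calc ‖q‖ = ‖q₁ + (q - q₁)‖ := by ring_nf
            _ ≤ ‖q₁‖ + ‖q - q₁‖ := norm_add_le _ _
        linarith
      have hqx₂ : q ∈ ball (proj q) ℓ' := by
        rw [mem_ball, hproj_dist q hq0, abs_of_nonneg (by linarith)]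
        have : ℓ' / 2 ≤ ℓ' := by linarith
        linarith
      exact hglue (proj q) hx₂ (proj q₁) hx₁ q ⟨hqx₂, hqx₁⟩
  -- ### `yt` is a good root on `|q| < s'`, contradiction with the maximality of `s`
  have hs's : s < s' := by rw [hs']; linarith
  have hs'R : s' ≤ R := by rw [hs']; linarith
  have hgood' : Good s' yt := by
    refine ⟨?_, ?_, ?_⟩
    · intro q₁ hq₁
      rw [mem_ball_zero_iff] at hq₁
      by_cases h₁ : ‖q₁‖ < s
      · -- inside: `yt = ys` near `q₁`
        have hev : yt =ᶠ[𝓝 q₁] ys := by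
          have : ∀ᶠ q in 𝓝 q₁, ‖q‖ < s :=
            (continuous_norm.continuousAt (x := q₁)).eventually (Iio_mem_nhds h₁)
          filter_upwards [this] with q hq
          rw [hyt]
          simp only [if_pos hq]
        have hd : DifferentiableAt ℂ ys q₁ :=
          hys.1.differentiableAt (isOpen_ball.mem_nhds (mem_ball_zero_iff.mpr h₁))
        exact (hd.congr_of_eventuallyEq hev).differentiableWithinAt
      · push Not at h₁
        obtain ⟨hball, hev⟩ := hkey q₁ h₁ hq₁
        have hq₁0 : q₁ ≠ 0 := by
          intro h; rw [h, norm_zero] at h₁; linarith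
        have hd : DifferentiableAt ℂ (Yx (proj q₁)) q₁ :=
          (hYxd (proj q₁) (hproj_sph q₁ hq₁0)).differentiableAt (isOpen_ball.mem_nhds hball)
        exact (hd.congr_of_eventuallyEq hev).differentiableWithinAt
    · intro q₁ hq₁
      rw [mem_ball_zero_iff] at hq₁
      by_cases h₁ : ‖q₁‖ < s
      · rw [hyt]
        simp only [if_pos h₁]
        exact hys.2.1 q₁ (mem_ball_zero_iff.mpr h₁)
      · push Not at h₁
        obtain ⟨hball, hev⟩ := hkey q₁ h₁ hq₁
        have hq₁0 : q₁ ≠ 0 := by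
          intro h; rw [h, norm_zero] at h₁; linarith
        rw [hev.eq_of_nhds]
        exact hYxroot (proj q₁) (hproj_sph q₁ hq₁0) q₁ hball
          (mem_ball_zero_iff.mpr (hq₁.trans_le hs'R))
    · intro q hq
      have hqs : ‖q‖ < s := (mem_ball_zero_iff.mp hq).trans_le hr₀s
      rw [hyt]
      simp only [if_pos hqs]
      exact hys.2.2 q hq
  have hs'mem : s' ∈ 𝓢 := ⟨hr₀s.trans hs's.le, hs'R, yt, hgood'⟩
  have : s' ≤ s := le_csSup h𝓢bdd hs'mem
  linarith

end RootContinuation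

end Literature.Analysis.Complex
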